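/-
Copyright (c) 2026. All rights reserved.
Released under Apache 2.0 license as described in the file LICENSE.
Authors: abc-iut cell, campaign-S prover seat abc-iut-S1 (wave 1).
-/
import Mathlib.NumberTheory.RamificationInertia.Basic
import Mathlib.NumberTheory.Padics.RingHoms
import Mathlib.FieldTheory.Finiteness
import Literature.IUT.LogVolume.RamificationInvariants
import Literature.IUT.LogVolume.IntegerRingFinite
import HarnessLib

/-!
# `e·f = [K : ℚ_p]` and the dictionary with Mathlib's ramification index / inertia degree

For a mixed-characteristic local field `K` in the cell's norm-side setting ([IUTchIV] §1: the text uses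
`e_i`, `f_i` and, in Prop. 1.4 / Thm. 1.10, `[k_i : ℚ_p] = e_i f_i` tacitly), this file PROVES:

* `norm_irreducible_eq` — an irreducible `ϖ₀ ∈ 𝒪_K` has `‖ϖ₀‖ = p^{−1/e}`; `span_natCast_prime_eq` —
  `p·𝒪_K = 𝔪^e`; `map_maximalIdeal_padicInt` — `𝔪_{ℤ_p}·𝒪_K = 𝔪^e`; `coe_maximalIdeal_pow_eq_pBall` —
  `𝔪^m = p^{m/e}·R` as subsets of `K`; `exists_different_eq_maximalIdeal_pow` — `𝔇 = 𝔪^δ`, `d = δ/e`;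
* `ramificationIdx'_eq` — Mathlib's `Ideal.ramificationIdx' 𝔪_{ℤ_p} 𝔪_K` IS `absRamificationIdx p K`;
* `finrank_residueField_eq` — `dim_{𝔽_p} (𝒪_K/𝔪) = f = residueDegree p K`, and `inertiaDeg'_eq` —
  Mathlib's `Ideal.inertiaDeg' 𝔪_{ℤ_p} 𝔪_K` IS `f`;
* `absRamificationIdx_mul_residueDegree` — **`e·f = [K : ℚ_p]`** (Mathlib's
  `finrank_prime_pow_ramificationIdx` + `finrank_quotient_map`).

Classical (Serre, *Local Fields*, Ch. I §4 Prop. 10, Ch. II §2 Cor. 1); nothing disputed.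
-/

noncomputable section

open Metric Set IsLocalRing Module
open scoped NormedField

namespace Literature.IUT.LogVolume

open Literature.NumberTheory.GaloisRepresentations.Ultrametric

variable (p : ℕ) [Fact p.Prime]
variable (K : Type*) [NontriviallyNormedField K] [instK : NormedAlgebra ℚ_[p] K] [IsUltrametricDist K]
  [ProperSpace K]
include instK

/-! ## Irreducibles of `𝒪_K` and `p·𝒪_K = 𝔪^e` -/

omit instK in
/-- An irreducible element of `𝒪_K` has the norm of a norm uniformizer. [claim: Mochizuki2012, status: disputed] -/
theorem norm_irreducible_eq_norm_of_isUniformizer {ϖ₀ : Valued.integer K} (hirr : Irreducible ϖ₀)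
    {ϖ : Kˣ} (hϖ : IsUniformizer ϖ) : ‖(ϖ₀ : K)‖ = ‖(ϖ : K)‖ := by
  have h0 : (ϖ₀ : K) ≠ 0 := fun h ↦ hirr.ne_zero (Subtype.ext h)
  have hlt : ‖(ϖ₀ : K)‖ < 1 := Valued.integer.norm_irreducible_lt_one hirr
  have hpos : 0 < ‖(ϖ₀ : K)‖ := norm_pos_iff.mpr h0
  -- `‖ϖ₀‖ = ‖ϖ‖^k` with `k ≥ 1`
  obtain ⟨k, hk⟩ := hϖ.2 (Units.mk0 (ϖ₀ : K) h0)
  rw [Units.val_mk0] at hk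
  have hk1 : 0 < k := (zpow_lt_one_iff_right_of_lt_one₀ (norm_units_pos ϖ) hϖ.1).mp (hk ▸ hlt)
  -- `‖ϖ‖ = ‖ϖ₀‖^n` with `n ≥ 1` (`ϖ` is a nonzero integer)
  obtain ⟨n, hn⟩ := exists_norm_eq_pow_of_norm_le_one hirr (ϖ : K) ϖ.ne_zero hϖ.1.le
  have hn1 : 0 < n := by
    rcases Nat.eq_zero_or_pos n with h | h
    · rw [h, pow_zero] at hn; exact absurd hn hϖ.1.ne
    · exact h
  -- hence `‖ϖ₀‖ = ‖ϖ₀‖^(n k)`, forcing `n k = 1`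
  have hkk : ‖(ϖ₀ : K)‖ = ‖(ϖ₀ : K)‖ ^ ((n : ℤ) * k) := by
    rw [zpow_mul, zpow_natCast, ← hn, ← hk]
  have hinj := zpow_right_injective₀ hpos hlt.ne (hkk.symm.trans (zpow_one _).symm)
  have hn_one : (n : ℤ) = 1 := Int.eq_one_of_mul_eq_one_right (by positivity) hinj
  have : n = 1 := by exact_mod_cast hn_one
  rw [hn, this, pow_one]

/-- **An irreducible `ϖ₀ ∈ 𝒪_K` has `‖ϖ₀‖ = p^{−1/e}`.** [claim: Mochizuki2012, status: disputed] -/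
theorem norm_irreducible_eq {ϖ₀ : Valued.integer K} (hirr : Irreducible ϖ₀) :
    ‖(ϖ₀ : K)‖ = (p : ℝ) ^ (-(1 / (absRamificationIdx p K : ℝ))) := by
  obtain ⟨ϖ, hϖ⟩ := exists_isUniformizer (F := K)
  rw [norm_irreducible_eq_norm_of_isUniformizer K hirr hϖ, norm_eq_rpow_of_isUniformizer p K hϖ]

/-- `‖p‖ = ‖ϖ₀‖^e` for an irreducible `ϖ₀ ∈ 𝒪_K`. [claim: Mochizuki2012, status: disputed] -/
theorem norm_prime_eq_norm_irreducible_pow {ϖ₀ : Valued.integer K} (hirr : Irreducible ϖ₀) :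
    ‖(p : K)‖ = ‖(ϖ₀ : K)‖ ^ absRamificationIdx p K := by
  obtain ⟨ϖ, hϖ⟩ := exists_isUniformizer (F := K)
  rw [norm_irreducible_eq_norm_of_isUniformizer K hirr hϖ, norm_prime_eq_norm_pow p K hϖ]

omit instK in
/-- In `𝒪_K`: a nonzero `x` with `‖x‖ = ‖ϖ₀‖ⁿ` generates `𝔪ⁿ` (`x = u·ϖ₀^m` with `m = n` by comparing
norms). [claim: Mochizuki2012, status: disputed] -/
theorem span_singleton_eq_maximalIdeal_pow {ϖ₀ : Valued.integer K} (hirr : Irreducible ϖ₀)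
    {x : Valued.integer K} (hx : x ≠ 0) {n : ℕ} (hn : ‖(x : K)‖ = ‖(ϖ₀ : K)‖ ^ n) :
    Ideal.span {x} = maximalIdeal (Valued.integer K) ^ n := by
  obtain ⟨m, u, hu⟩ := IsDiscreteValuationRing.eq_unit_mul_pow_irreducible hx hirr
  have hlt : ‖(ϖ₀ : K)‖ < 1 := Valued.integer.norm_irreducible_lt_one hirr
  have hpos : 0 < ‖(ϖ₀ : K)‖ := Valued.integer.norm_irreducible_pos hirr
  have hm : ‖(x : K)‖ = ‖(ϖ₀ : K)‖ ^ m := by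
    have h := congrArg (fun z : Valued.integer K ↦ ‖(z : K)‖) hu
    rw [h]
    push_cast
    rw [norm_mul, norm_pow, Valued.integer.norm_coe_unit, one_mul]
  have hmn : m = n := pow_right_injective₀ hpos hlt.ne (hm.symm.trans hn)
  rw [hu, Ideal.span_singleton_mul_left_unit u.isUnit, ← Ideal.span_singleton_pow,
    ← (IsDiscreteValuationRing.irreducible_iff_uniformizer ϖ₀).mp hirr, hmn]

omit [ProperSpace K] in
/-- `(p : 𝒪_K) ≠ 0`. [claim: Mochizuki2012, status: disputed] -/
theorem natCast_prime_integer_ne_zero : (p : Valued.integer K) ≠ 0 := by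
  intro h
  have := congrArg (fun z : Valued.integer K ↦ (z : K)) h
  simp only [SubringClass.coe_natCast, ZeroMemClass.coe_zero] at this
  exact prime_ne_zero p K this

/-- **`p·𝒪_K = 𝔪^e`.** [claim: Mochizuki2012, status: disputed] -/
theorem span_natCast_prime_eq :
    Ideal.span {(p : Valued.integer K)} = maximalIdeal (Valued.integer K) ^ absRamificationIdx p K := by
  obtain ⟨ϖ₀, hirr⟩ := IsDiscreteValuationRing.exists_irreducible (Valued.integer K)
  refine span_singleton_eq_maximalIdeal_pow K hirr (natCast_prime_integer_ne_zero p K) ?_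
  rw [SubringClass.coe_natCast]
  exact norm_prime_eq_norm_irreducible_pow p K hirr

/-- **`𝔪_{ℤ_p}·𝒪_K = 𝔪^e`** (`𝔪_{ℤ_p} = p·ℤ_p`). [claim: Mochizuki2012, status: disputed] -/
theorem map_maximalIdeal_padicInt :
    Ideal.map (algebraMap ℤ_[p] (Valued.integer K)) (maximalIdeal ℤ_[p]) =
      maximalIdeal (Valued.integer K) ^ absRamificationIdx p K := by
  rw [PadicInt.maximalIdeal_eq_span_p, Ideal.map_span, Set.image_singleton, map_natCast,
    span_natCast_prime_eq]

/-- **`𝔇 = 𝔪^δ` and `d = δ/e ∈ (1/e)·ℕ`**: the different is a power of the maximal ideal and its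
order `d` ("`d_i ∈ ℚ_{≥0}`", [IUTchIV] Prop. 1.1 p. 9) is `δ/e`. [claim: Mochizuki2012, status: disputed] -/
theorem exists_different_eq_maximalIdeal_pow :
    ∃ δ : ℕ, different p K = maximalIdeal (Valued.integer K) ^ δ ∧
      differentOrd p K = (δ : ℝ) / absRamificationIdx p K := by
  obtain ⟨g, hg⟩ := exists_different_eq_span p K
  have hg0 : g ≠ 0 := generator_ne_zero p K hg
  obtain ⟨ϖ₀, hirr⟩ := IsDiscreteValuationRing.exists_irreducible (Valued.integer K)
  obtain ⟨δ, u, hu⟩ := IsDiscreteValuationRing.eq_unit_mul_pow_irreducible hg0 hirr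
  have hnorm : ‖(g : K)‖ = ‖(ϖ₀ : K)‖ ^ δ := by
    have h := congrArg (fun z : Valued.integer K ↦ ‖(z : K)‖) hu
    rw [h]
    push_cast
    rw [norm_mul, norm_pow, Valued.integer.norm_coe_unit, one_mul]
  refine ⟨δ, ?_, ?_⟩
  · rw [hg, span_singleton_eq_maximalIdeal_pow K hirr hg0 hnorm]
  · have hp1 : (1 : ℝ) < p := by exact_mod_cast (Fact.out : p.Prime).one_lt
    have hp0 : (0 : ℝ) < p := by linarith
    rw [differentOrd_eq_of_span p K hg, hnorm, norm_irreducible_eq p K hirr, ← Real.rpow_natCast,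
      ← Real.rpow_mul hp0.le, Real.logb_rpow hp0 hp1.ne']
    ring

/-- **`𝔪^m = p^{m/e}·R`**: the `m`-th power of the maximal ideal, viewed in `K`, is the ball
`{‖x‖ ≤ p^{−m/e}}` = `pBall p K (m/e)` (the dictionary between the ideal-theoretic filtration used by the
volume computations and the `p^λ·R` of [IUTchIV] §1). [claim: Mochizuki2012, status: disputed] -/
theorem coe_maximalIdeal_pow_eq_pBall (m : ℕ) :
    Subtype.val '' ((maximalIdeal (Valued.integer K) ^ m : Ideal (Valued.integer K)) :
      Set (Valued.integer K)) = pBall p K ((m : ℝ) / absRamificationIdx p K) := by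
  have hp1 : (1 : ℝ) < p := by exact_mod_cast (Fact.out : p.Prime).one_lt
  have hp0 : (0 : ℝ) < p := by linarith
  obtain ⟨ϖ₀, hirr⟩ := IsDiscreteValuationRing.exists_irreducible (Valued.integer K)
  have hset := hirr.maximalIdeal_pow_eq_closedBall_pow m
  have hpow : ‖ϖ₀‖ ^ m = (p : ℝ) ^ (-((m : ℝ) / absRamificationIdx p K)) := by
    change ‖(ϖ₀ : K)‖ ^ m = _
    rw [norm_irreducible_eq p K hirr, ← Real.rpow_natCast, ← Real.rpow_mul hp0.le]
    congr 1; ring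
  ext x
  rw [mem_pBall_iff]
  constructor
  · rintro ⟨y, hy, rfl⟩
    have hy' : y ∈ ((maximalIdeal (Valued.integer K) ^ m : Ideal (Valued.integer K)) :
        Set (Valued.integer K)) := hy
    rw [hset, Metric.mem_closedBall, dist_zero_right, hpow] at hy'
    exact hy'
  · intro hx
    have hx1 : ‖x‖ ≤ 1 := hx.trans (Real.rpow_le_one_of_one_le_of_nonpos hp1.le (by
      have : (0 : ℝ) ≤ (m : ℝ) / absRamificationIdx p K := by positivity
      linarith))
    refine ⟨⟨x, Valued.integer.mem_iff.mpr hx1⟩, ?_, rfl⟩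
    rw [hset, Metric.mem_closedBall, dist_zero_right, hpow]
    exact hx

/-! ## `e` is Mathlib's ramification index -/

omit instK in
/-- The powers of `𝔪` strictly decrease. [claim: Mochizuki2012, status: disputed] -/
theorem maximalIdeal_pow_succ_lt (n : ℕ) :
    ¬ maximalIdeal (Valued.integer K) ^ n ≤ maximalIdeal (Valued.integer K) ^ (n + 1) := by
  have hne : maximalIdeal (Valued.integer K) ≠ ⊥ := IsDiscreteValuationRing.not_a_field _
  exact (Ideal.pow_succ_lt_pow hne n).2

/-- **Mathlib's ramification index of `𝔪_K` over `𝔪_{ℤ_p}` is `e`.** [claim: Mochizuki2012, status: disputed] -/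
theorem ramificationIdx'_eq :
    Ideal.ramificationIdx' (maximalIdeal ℤ_[p]) (maximalIdeal (Valued.integer K)) =
      absRamificationIdx p K := by
  refine Ideal.ramificationIdx'_spec (le_of_eq (map_maximalIdeal_padicInt p K)) ?_
  rw [map_maximalIdeal_padicInt]
  exact maximalIdeal_pow_succ_lt K _

/-! ## `f` is Mathlib's inertia degree -/

/-- `𝔪_K` lies over `𝔪_{ℤ_p}` (a theorem, to be activated with `haveI`).
[claim: Mochizuki2012, status: disputed] -/
theorem liesOver_maximalIdeal :
    (maximalIdeal (Valued.integer K)).LiesOver (maximalIdeal ℤ_[p]) := by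
  refine ⟨(IsLocalRing.maximalIdeal.isMaximal ℤ_[p]).eq_of_le ?_ ?_⟩
  · exact Ideal.IsPrime.ne_top inferInstance
  · rw [PadicInt.maximalIdeal_eq_span_p, Ideal.span_le, Set.singleton_subset_iff, SetLike.mem_coe,
      Ideal.under_def, Ideal.mem_comap, map_natCast, mem_maximalIdeal_iff_norm_lt_one]
    change ‖((p : Valued.integer K) : K)‖ < 1
    rw [SubringClass.coe_natCast]
    exact norm_prime_lt_one p K

/-- **`dim_{𝔽_p}(𝒪_K/𝔪) = f`** for ANY `ℤ_p/p`-vector space structure on `𝒪_K/𝔪` (cardinality count: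
`p^{dim} = #(𝒪_K/𝔪) = p^f`). [claim: Mochizuki2012, status: disputed] -/
theorem finrank_residueField_eq
    [Module (ℤ_[p] ⧸ maximalIdeal ℤ_[p]) (Valued.integer K ⧸ maximalIdeal (Valued.integer K))] :
    finrank (ℤ_[p] ⧸ maximalIdeal ℤ_[p]) (Valued.integer K ⧸ maximalIdeal (Valued.integer K)) =
      residueDegree p K := by
  letI : Field (ℤ_[p] ⧸ maximalIdeal ℤ_[p]) := Ideal.Quotient.field (maximalIdeal ℤ_[p])
  haveI : Finite (Valued.integer K ⧸ maximalIdeal (Valued.integer K)) :=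
    (finite_residueField : Finite (ResidueField (Valued.integer K)))
  have hcard := Module.natCard_eq_pow_finrank (K := ℤ_[p] ⧸ maximalIdeal ℤ_[p])
    (V := Valued.integer K ⧸ maximalIdeal (Valued.integer K))
  have hp : Nat.card (ℤ_[p] ⧸ maximalIdeal ℤ_[p]) = p := by
    change Nat.card (ResidueField ℤ_[p]) = p
    rw [Nat.card_congr (PadicInt.residueField (p := p)).toEquiv, Nat.card_zmod]
  have hK : Nat.card (Valued.integer K ⧸ maximalIdeal (Valued.integer K)) = p ^ residueDegree p K :=
    card_residueField p K
  rw [hK, hp] at hcard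
  exact (Nat.pow_right_injective (Fact.out : p.Prime).two_le hcard).symm

/-- **Mathlib's inertia degree of `𝔪_K` over `𝔪_{ℤ_p}` is `f`.** [claim: Mochizuki2012, status: disputed] -/
theorem inertiaDeg'_eq :
    Ideal.inertiaDeg' (maximalIdeal ℤ_[p]) (maximalIdeal (Valued.integer K)) = residueDegree p K := by
  haveI := liesOver_maximalIdeal p K
  rw [Ideal.inertiaDeg'_algebraMap]
  exact finrank_residueField_eq p K

/-! ## The fundamental identity `e·f = [K : ℚ_p]` -/

omit instK [IsUltrametricDist K] [ProperSpace K] in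
/-- Counting: a finite `ℤ_p/p`-vector space `V` has `p^{dim V}` elements.
[claim: Mochizuki2012, status: disputed] -/
theorem natCard_eq_prime_pow_finrank (V : Type*) [AddCommGroup V]
    [Module (ℤ_[p] ⧸ maximalIdeal ℤ_[p]) V] [Finite V] :
    Nat.card V = p ^ finrank (ℤ_[p] ⧸ maximalIdeal ℤ_[p]) V := by
  letI : Field (ℤ_[p] ⧸ maximalIdeal ℤ_[p]) := Ideal.Quotient.field (maximalIdeal ℤ_[p])
  have hp : Nat.card (ℤ_[p] ⧸ maximalIdeal ℤ_[p]) = p := by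
    change Nat.card (ResidueField ℤ_[p]) = p
    rw [Nat.card_congr (PadicInt.residueField (p := p)).toEquiv, Nat.card_zmod]
  rw [Module.natCard_eq_pow_finrank (K := ℤ_[p] ⧸ maximalIdeal ℤ_[p]), hp]

/-- **The fundamental identity `e·f = [K : ℚ_p]`** (one prime above `p`; Mathlib's
`finrank_prime_pow_ramificationIdx` and `finrank_quotient_map`, compared through the cardinalities of
`𝒪_K/p𝒪_K = 𝒪_K/𝔪^e`). [claim: Mochizuki2012, status: disputed] -/
theorem absRamificationIdx_mul_residueDegree :
    absRamificationIdx p K * residueDegree p K = finrank ℚ_[p] K := by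
  letI : Field (ℤ_[p] ⧸ maximalIdeal ℤ_[p]) := Ideal.Quotient.field (maximalIdeal ℤ_[p])
  set 𝔭 := maximalIdeal ℤ_[p] with h𝔭
  set 𝔪 := maximalIdeal (Valued.integer K) with h𝔪
  have h𝔪0 : 𝔪 ≠ ⊥ := IsDiscreteValuationRing.not_a_field _
  have he : Ideal.ramificationIdx' 𝔭 𝔪 = absRamificationIdx p K := ramificationIdx'_eq p K
  have he0 : Ideal.ramificationIdx' 𝔭 𝔪 ≠ 0 := by rw [he]; exact (absRamificationIdx_pos p K).ne'
  have hmap : Ideal.map (algebraMap ℤ_[p] (Valued.integer K)) 𝔭 = 𝔪 ^ Ideal.ramificationIdx' 𝔭 𝔪 := by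
    rw [he]; exact map_maximalIdeal_padicInt p K
  -- finiteness of the quotients involved
  haveI : Finite (ℤ_[p] ⧸ 𝔭) := Finite.of_equiv _ (PadicInt.residueField (p := p)).toEquiv.symm
  haveI hfin1 : Finite (Valued.integer K ⧸ Ideal.map (algebraMap ℤ_[p] (Valued.integer K)) 𝔭) :=
    Module.finite_of_finite (ℤ_[p] ⧸ 𝔭)
  haveI hfin2 : Finite (Valued.integer K ⧸ 𝔪 ^ Ideal.ramificationIdx' 𝔭 𝔪) :=
    Finite.of_equiv _ (Ideal.quotEquivOfEq hmap).toEquiv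
  haveI hfin3 : Finite (Valued.integer K ⧸ 𝔪) := (finite_residueField : Finite (ResidueField _))
  -- (2) `#(𝒪/p𝒪) = p^[K:ℚ_p]`
  have h2 := Ideal.finrank_quotient_map (R := ℤ_[p]) (S := Valued.integer K) 𝔭 ℚ_[p] K
  have c2 : Nat.card (Valued.integer K ⧸ Ideal.map (algebraMap ℤ_[p] (Valued.integer K)) 𝔭) =
      p ^ finrank ℚ_[p] K := by
    rw [natCard_eq_prime_pow_finrank p, h2]
  -- (1) `#(𝒪/𝔪^e) = p^(e f)`
  have h1 := Ideal.finrank_prime_pow_ramificationIdx (p := 𝔭) (P := 𝔪) h𝔪0 he0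
  letI instQ : Algebra (ℤ_[p] ⧸ 𝔭) (Valued.integer K ⧸ 𝔪) :=
    @Ideal.Quotient.algebraQuotientOfRamificationIdxNeZero _ _ _ _ _ 𝔭 𝔪 ⟨he0⟩
  have hf : finrank (ℤ_[p] ⧸ 𝔭) (Valued.integer K ⧸ 𝔪) = residueDegree p K :=
    finrank_residueField_eq p K
  rw [hf] at h1
  have c1 : Nat.card (Valued.integer K ⧸ 𝔪 ^ Ideal.ramificationIdx' 𝔭 𝔪) =
      p ^ (Ideal.ramificationIdx' 𝔭 𝔪 * residueDegree p K) := by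
    rw [natCard_eq_prime_pow_finrank p, h1]
  -- compare
  have c12 : Nat.card (Valued.integer K ⧸ Ideal.map (algebraMap ℤ_[p] (Valued.integer K)) 𝔭) =
      Nat.card (Valued.integer K ⧸ 𝔪 ^ Ideal.ramificationIdx' 𝔭 𝔪) :=
    Nat.card_congr (Ideal.quotEquivOfEq hmap).toEquiv
  rw [c1, c2, ← he] at *
  exact (Nat.pow_right_injective (Fact.out : p.Prime).two_le c12).symm

end Literature.IUT.LogVolume

end
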